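import Summits.ResolutionOfSingularities.ResolutionOfSingularities.Theorems.HilbertSamuelEliminationSigmaMaxModificationsCorridor3SigmaHybridElimination
import HarnessLib

/-!
# [OURS · L1 W4.2] (E6a) SCOPE WIRING: the run-wise scope of an ADMISSIBLE boundary-aware strategy from a maximal origin is GOOD
# (reduced, excellent, `dim ≤ N`, closed `ν`-stratum at every run-reachable stage), and the `StateScopeGood`-FREE E6 socket at the hybrid
# (cell res-hironaka, LADDER-RESOLUTION rung L; slot W4.2, crux chain w42 `SigmaMaxModificationsCorridor3` stmt-ResolutionOfSingularities-19249 /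
# crux stmt-…-18506; res-L1-w42-plan-1 WORD 2026-08-27T11:54:33Z (E6a); hand res-D-pv-047 AS res-L1-s46-pv-10;
# `--supports stmt-ResolutionOfSingularities-19249 --as helper`)

HONEST FRAMING. OURS proof architecture; NOTHING is a statement of H. Hironaka's manuscript [Hironaka2017] nor of Cossart–Jannsen–Saito; no named fact is
introduced (CJS Thm. 3.10 (1) and Thm. 2.33 (3) enter through the tree's PROVED theorems, Stacks 07QW through the tree's `Stacks07QW_field_holds`).
AI-written; AI review is weaker than expert review.

## What is here (namespace `…Theorems.SigmaMaxModificationsCorridor3.Sigma`)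

* `RunGood k N ν W` — the invariant carried along a run: `W` of finite type over the field `k`, reduced, `dim W ≤ N`, and `ν` never exceeded by `H^N_W`
  (the fields of `StateGoodσE` minus the strategy-dependent «permissible runs»); `RunGood.init` from `IsMaximalOrigin`; `RunGood.stateGood` (reduced ∧
  excellent ∧ `dim ≤ N` ∧ closed stratum — the four clauses of o1's `StateScopeGood`); **`RunGood.next`** — it PROPAGATES along the blow-up in a
  PERMISSIBLE centre (`IsBlowup.isReduced_of_isReduced`, `topologicalKrullDim_le_of_isLocallyNoetherian`, CJS 3.10 (1) `hsFun_le_of_isPermissible` for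
  «`ν` never exceeded» — the induction of `StateGoodσE.next`, re-run because `StateGoodσE` carries the run-level `permRuns` clause a scope statement
  cannot feed stage by stage).
* **`stateScopeGood_runReachableState`** — for `σ : StrategyE` ADMISSIBLE on its run-wise scope `StrategyE.RunReachableState p σ N ν E₀` (p527149):
  `StateScopeGood N ν (StrategyE.RunReachableState p σ N ν E₀)` (induction along `StateReachesσE`, permissibility of each centre from admissibility at
  the — run-reachable — state it is taken from). σ-parametric; functionality is NOT needed.
* **`nuMod_of_hybrid_noInfiniteNearChain'`** / **`nuMod_of_hybrid_ofStageOracleE_noInfiniteNearChain'`** — the E6 socket at the hybrid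
  (`…SigmaHybridElimination.lean`, p528862) WITHOUT the `StateScopeGood` hypothesis: admissibility of `π.hybrid τ` and goodness of its run-wise scope are
  obtained TOGETHER by one induction (`runGood_hybrid_of_stateReachesσE`, `stateScopeGood_runReachableState_hybrid`,
  `hybrid_isAdmissibleOnRunReachable'`), since o1's plug `isAdmissibleStrategyOnE_hybrid_plus` wants the good
  scope and the good scope wants admissibility — the knot is cut stage by stage along `StateReachesσE` (goodness of the CURRENT stage gives clause (a) of
  the menu-disciplined policy there, hence permissibility of the step taken, hence goodness of the NEXT stage).

## References (context)

* V. Cossart, U. Jannsen, S. Saito, LNM 2270 (2020), Rem. 6.29 (1), Thm. 2.33, Thm. 3.10 (1), Thm. 6.6. [CossartJannsenSaito2020]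
-/

noncomputable section

set_option linter.dupNamespace false -- mandated namespace of this single-conjunct summit

open CategoryTheory AlgebraicGeometry TopologicalSpace Topology
open Summit.ResolutionOfSingularities.ResolutionOfSingularities.Theorems.CampaignW42
open Literature.AlgebraicGeometry.Resolution Literature.RingTheory.HilbertSamuel
open Literature.AlgebraicGeometry.CossartJannsenSaito2020

namespace Summit.ResolutionOfSingularities.ResolutionOfSingularities.Theorems.SigmaMaxModificationsCorridor3.Sigma

universe u

/-! ## §1. The run invariant and its propagation along a permissible blow-up -/

/-- [OURS · L1 W4.2] THE INVARIANT CARRIED ALONG A RUN at a stage `W`: `W` of finite type over the ground field `k`, reduced, `dim W ≤ N`, and `ν` never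
exceeded by `H^N_W` (so `W(ν) = W(≥ ν)` is closed). Strategy-free part of `StateGoodσE`. OURS bookkeeping; NOT a statement of the manuscript.
[folklore] -/
structure RunGood (k : Type u) [Field k] (N : ℕ) (ν : ℕ → ℕ) (W : Scheme.{u}) : Prop where
  /-- `W` is of finite type over `k` -/
  overField : ∃ f : W ⟶ Spec (.of k), LocallyOfFiniteType f ∧ QuasiCompact f
  /-- `W` is reduced -/
  isReduced : IsReduced W
  /-- the level bounds the dimension -/
  dim_le : topologicalKrullDim W ≤ (N : WithBot ℕ∞)
  /-- `ν` is never exceeded -/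
  supMax : ∀ w : W, ν ≤ Scheme.hsFun W N w → Scheme.hsFun W N w = ν

namespace RunGood

variable {k : Type u} [Field k] {N : ℕ} {ν : ℕ → ℕ} {W : Scheme.{u}}

/-- The invariant holds at a maximal origin (`X` reduced of finite type over a field, `dim X ≤ N`, `ν` a maximal value). [folklore] -/
theorem init {p : ℕ} {X : Scheme.{u}} {x : X} (hx : IsMaximalOrigin p N ν X x) : ∃ (k : Type u) (_ : Field k), RunGood k N ν X := by
  obtain ⟨k, hk, _, f, -, hft, hqc⟩ := hx.exists_structure
  exact ⟨k, hk, ⟨f, hft, hqc⟩, hx.isReduced, hx.dim_le, fun w hw => le_antisymm (hx.maximal.2 ⟨w, rfl⟩ hw) hw⟩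

/-- A good stage is locally Noetherian. [folklore] -/
theorem isLocallyNoetherian (h : RunGood k N ν W) : IsLocallyNoetherian W := by
  obtain ⟨f, hf, -⟩ := h.overField
  exact LocallyOfFiniteType.isLocallyNoetherian f

/-- A good stage is excellent. [cite: StacksProject, Tag 07QW] -/
theorem isExcellent (h : RunGood k N ν W) : Scheme.IsExcellent W := by
  obtain ⟨f, hf, -⟩ := h.overField
  exact Scheme.isExcellent_of_locallyOfFiniteType Stacks07QW_field_holds f

/-- At a good stage the `ν`-stratum is closed. [cite: CossartJannsenSaito2020, Lemma 2.36 (a)] -/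
theorem isClosed_hsStratum (h : RunGood k N ν W) : IsClosed (Scheme.hsStratum W N ν) := by
  obtain ⟨f, hf, hq⟩ := h.overField
  rw [hsStratum_eq_hsStratumGE_of_supMax h.supMax]
  exact isClosed_hsStratumGE_over_field f h.dim_le ν

/-- The four clauses of `StateScopeGood` at a good stage. [folklore] -/
theorem stateGood (h : RunGood k N ν W) :
    IsReduced W ∧ Scheme.IsExcellent W ∧ topologicalKrullDim W ≤ (N : WithBot ℕ∞) ∧ IsClosed (Scheme.hsStratum W N ν) :=
  ⟨h.isReduced, h.isExcellent, h.dim_le, h.isClosed_hsStratum⟩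

/-- **The invariant PROPAGATES along the blow-up in a PERMISSIBLE centre** (reducedness CJS Thm. 6.6 / `IsBlowup.isReduced_of_isReduced`; dimension
Matsumura 15.5; «`ν` never exceeded» by CJS Thm. 3.10 (1)). [cite: CossartJannsenSaito2020, Thm. 3.10 (1), Thm. 6.6] -/
theorem next (h : RunGood k N ν W) {C : W.IdealSheafData} (hC : IdealSheafData.IsPermissible C) : RunGood k N ν (blowup C) := by
  haveI := h.isLocallyNoetherian
  haveI := h.isReduced
  haveI : IsProper (blowup.π C) := (blowup.isBlowup C).isProper
  obtain ⟨f, hf, hq⟩ := h.overField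
  refine ⟨⟨blowup.π C ≫ f, inferInstance, inferInstance⟩, (blowup.isBlowup C).isReduced_of_isReduced,
    (blowup.isBlowup C).topologicalKrullDim_le_of_isLocallyNoetherian h.dim_le, fun z hz => ?_⟩
  have hle : Scheme.hsFun (blowup C) N z ≤ Scheme.hsFun W N ((blowup.π C).base z) :=
    (blowup.isBlowup C).hsFun_le_of_isPermissible h.isExcellent hC N z
  have heq := h.supMax _ (hz.trans hle)
  exact le_antisymm (heq ▸ hle) hz

end RunGood

/-! ## §2. The run-wise scope of an admissible strategy is good -/

section Scope

variable {p N : ℕ} {ν : ℕ → ℕ} {σ : StrategyE.{u}} {E₀ : ∀ (X : Scheme.{u}), X → Boundary X}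

/-- Along a chain of σ-steps on states from the initial state of a maximal origin, the run invariant holds at the end, PROVIDED every step taken from a
run-reachable state has a permissible centre (e.g. σ admissible on its run-wise scope). [folklore] -/
theorem runGood_of_stateReachesσE {k : Type u} [Field k] {X : Scheme.{u}} {hX : IsLocallyNoetherian X} {x : X}
    (hx : IsMaximalOrigin p N ν X x) (h0 : RunGood k N ν X)
    (hperm : ∀ (W : Scheme.{u}) (hW : IsLocallyNoetherian W) (L : Labelling W) (P : Option (Pending W)) (E : Boundary W),
      StrategyE.RunReachableState p σ N ν E₀ W hW L P E →
        ∀ (C : W.IdealSheafData) (P' : Option (Pending (blowup C))), σ.step W hW N ν L P E C P' → IdealSheafData.IsPermissible C)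
    {t : StateσE.{u}} (hreach : StateReachesσE σ N ν (StateσE.init X hX (E₀ X x)) t) : RunGood k N ν t.W := by
  induction hreach with
  | refl => exact h0
  | tail hab hbc ih =>
    rename_i b c
    obtain ⟨C, P', hln, hstep, rfl⟩ := hbc
    have hscope : StrategyE.RunReachableState p σ N ν E₀ b.W b.ln b.L b.P b.E := ⟨X, hX, x, hx, hab⟩
    exact ih.next (hperm _ _ _ _ _ hscope C P' hstep)

/-- **(E6a) THE RUN-WISE SCOPE OF AN ADMISSIBLE STRATEGY IS GOOD**: for `σ : StrategyE` admissible on `StrategyE.RunReachableState p σ N ν E₀`, every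
run-reachable stage is reduced, excellent, of dimension `≤ N` and has a closed `ν`-stratum. [cite: CossartJannsenSaito2020, Thm. 3.10 (1), Thm. 6.6] -/
theorem stateScopeGood_runReachableState (hadm : IsAdmissibleStrategyOnE (StrategyE.RunReachableState p σ N ν E₀) N ν σ) :
    StateScopeGood N ν (StrategyE.RunReachableState p σ N ν E₀) := by
  intro W hW L P E hS
  obtain ⟨X, hX, x, hx, hreach⟩ := hS
  obtain ⟨k, hk, h0⟩ := RunGood.init hx
  have hperm : ∀ (W : Scheme.{u}) (hW : IsLocallyNoetherian W) (L : Labelling W) (P : Option (Pending W)) (E : Boundary W),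
      StrategyE.RunReachableState p σ N ν E₀ W hW L P E →
        ∀ (C : W.IdealSheafData) (P' : Option (Pending (blowup C))), σ.step W hW N ν L P E C P' → IdealSheafData.IsPermissible C :=
    fun W hW L P E hS C P' hstep => ((hadm W hW L P E hS).1 C P' hstep).1
  exact (runGood_of_stateReachesσE (t := ⟨⟨W, hW, L, P⟩, E⟩) hx h0 hperm hreach).stateGood

end Scope

/-! ## §3. The hybrid: admissibility and goodness of its run-wise scope TOGETHER, and the `StateScopeGood`-free E6 socket -/

section Hybrid

variable {p N : ℕ} {ν : ℕ → ℕ} {π τ : StrategyE.{u}} {E₀ : ∀ (X : Scheme.{u}), X → Boundary X}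

/-- Along a chain of hybrid steps from a maximal origin the run invariant holds — the knot «goodness needs admissibility, admissibility needs goodness» cut
stage by stage: at a good stage the menu-disciplined policy's steps have permissible centres (o1's `menuClauseA_plus` on the singleton scope of that
state), and the fallback's by hypothesis. [cite: CossartJannsenSaito2020, Thm. 3.10 (1), Rem. 6.29 (1)] -/
theorem runGood_hybrid_of_stateReachesσE {k : Type u} [Field k] (hπd : π.IsMenuDisciplined N ν) (hν : ν ≠ iterPSum N Phi)
    (hτa : ∀ (W : Scheme.{u}) (hW : IsLocallyNoetherian W) (L : Labelling W) (P : Option (Pending W)) (E : Boundary W),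
      StrategyE.RunReachableState p (π.hybrid τ) N ν E₀ W hW L P E →
      ∀ (C : W.IdealSheafData) (P' : Option (Pending (blowup C))), τ.step W hW N ν L P E C P' →
        IdealSheafData.IsPermissible C ∧ (C.support : Set W) ⊆ Scheme.hsStratum W N ν ∧
          ((Scheme.hsStratum W N ν).Nonempty → (C.support : Set W).Nonempty))
    {X : Scheme.{u}} {hX : IsLocallyNoetherian X} {x : X} (hx : IsMaximalOrigin p N ν X x) (h0 : RunGood k N ν X)
    {t : StateσE.{u}} (hreach : StateReachesσE (π.hybrid τ) N ν (StateσE.init X hX (E₀ X x)) t) : RunGood k N ν t.W := by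
  induction hreach with
  | refl => exact h0
  | tail hab hbc ih =>
    rename_i b c
    obtain ⟨C, P', hln, hstep, rfl⟩ := hbc
    have hscope : StrategyE.RunReachableState p (π.hybrid τ) N ν E₀ b.W b.ln b.L b.P b.E := ⟨X, hX, x, hx, hab⟩
    -- the singleton scope of the current state is good
    let 𝒮b : StateScopeE.{u} := fun W hW L P E => StrategyE.RunReachableState p (π.hybrid τ) N ν E₀ W hW L P E ∧ RunGood k N ν W
    have h𝒮b : StateScopeGood N ν 𝒮b := fun W hW L P E hW' => hW'.2.stateGood
    have hperm : IdealSheafData.IsPermissible C := by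
      rcases StrategyE.hybrid_step_cases hstep with hπ | hτ
      · exact (hπd.clauseA (menuClauseA_plus h𝒮b hν) (show 𝒮b b.W b.ln b.L b.P b.E from ⟨hscope, ih⟩) hπ).1
      · exact (hτa _ _ _ _ _ hscope C P' hτ).1
    exact ih.next hperm

/-- **THE RUN-WISE SCOPE OF THE HYBRID IS GOOD** (no `StateScopeGood` hypothesis): menu-disciplined policy, fallback with clause (a) on the scope,
`ν ≠ Φ^{(N)}`. [cite: CossartJannsenSaito2020, Thm. 3.10 (1), Rem. 6.29 (1)] -/
theorem stateScopeGood_runReachableState_hybrid (hπd : π.IsMenuDisciplined N ν) (hν : ν ≠ iterPSum N Phi)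
    (hτa : ∀ (W : Scheme.{u}) (hW : IsLocallyNoetherian W) (L : Labelling W) (P : Option (Pending W)) (E : Boundary W),
      StrategyE.RunReachableState p (π.hybrid τ) N ν E₀ W hW L P E →
      ∀ (C : W.IdealSheafData) (P' : Option (Pending (blowup C))), τ.step W hW N ν L P E C P' →
        IdealSheafData.IsPermissible C ∧ (C.support : Set W) ⊆ Scheme.hsStratum W N ν ∧
          ((Scheme.hsStratum W N ν).Nonempty → (C.support : Set W).Nonempty)) :
    StateScopeGood N ν (StrategyE.RunReachableState p (π.hybrid τ) N ν E₀) := by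
  intro W hW L P E hS
  obtain ⟨X, hX, x, hx, hreach⟩ := hS
  obtain ⟨k, hk, h0⟩ := RunGood.init hx
  exact (runGood_hybrid_of_stateReachesσE (t := ⟨⟨W, hW, L, P⟩, E⟩) hπd hν hτa hx h0 hreach).stateGood

/-- **The hybrid is admissible on its run-wise scope** WITHOUT a `StateScopeGood` hypothesis. [cite: CossartJannsenSaito2020, Def. 3.1, Rem. 6.29 (1)] -/
theorem hybrid_isAdmissibleOnRunReachable' (hπd : π.IsMenuDisciplined N ν) (hν : ν ≠ iterPSum N Phi)
    (hτa : ∀ (W : Scheme.{u}) (hW : IsLocallyNoetherian W) (L : Labelling W) (P : Option (Pending W)) (E : Boundary W),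
      StrategyE.RunReachableState p (π.hybrid τ) N ν E₀ W hW L P E →
      ∀ (C : W.IdealSheafData) (P' : Option (Pending (blowup C))), τ.step W hW N ν L P E C P' →
        IdealSheafData.IsPermissible C ∧ (C.support : Set W) ⊆ Scheme.hsStratum W N ν ∧
          ((Scheme.hsStratum W N ν).Nonempty → (C.support : Set W).Nonempty))
    (hτt : ∀ (W : Scheme.{u}) (hW : IsLocallyNoetherian W) (L : Labelling W) (P : Option (Pending W)) (E : Boundary W),
      StrategyE.RunReachableState p (π.hybrid τ) N ν E₀ W hW L P E →
      (Scheme.hsStratum W N ν).Nonempty → ∃ (C : W.IdealSheafData) (P' : Option (Pending (blowup C))), τ.step W hW N ν L P E C P') :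
    IsAdmissibleStrategyOnE (StrategyE.RunReachableState p (π.hybrid τ) N ν E₀) N ν (π.hybrid τ) :=
  hybrid_isAdmissibleOnRunReachable hπd (stateScopeGood_runReachableState_hybrid hπd hν hτa) hν hτa hτt

end Hybrid

section Packaging

variable {p : ℕ} {ν : ℕ → ℕ} {π τ : StrategyE.{0}} {E₀ : ∀ (X : Scheme.{0}), X → Boundary X}

/-- **THE E6 SOCKET AT THE HYBRID, `StateScopeGood`-FREE**: `nuMod_of_hybrid_noInfiniteNearChain` (p528862) with the goodness of the run-wise scope
DISCHARGED by `stateScopeGood_runReachableState_hybrid`. [cite: CossartJannsenSaito2020, Def. 6.14, Thm. 3.10 (1)] -/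
theorem nuMod_of_hybrid_noInfiniteNearChain' (hπd : π.IsMenuDisciplined 3 ν) (hπf : π.IsFunctional 3 ν)
    (hτf : τ.IsFunctional 3 ν) (hτne : τ.StepsOnlyWhileNonempty 3 ν) (hν : ν ≠ iterPSum 3 Phi)
    (hτa : ∀ (W : Scheme.{0}) (hW : IsLocallyNoetherian W) (L : Labelling W) (P : Option (Pending W)) (E : Boundary W),
      StrategyE.RunReachableState p (π.hybrid τ) 3 ν E₀ W hW L P E →
      ∀ (C : W.IdealSheafData) (P' : Option (Pending (blowup C))), τ.step W hW 3 ν L P E C P' →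
        IdealSheafData.IsPermissible C ∧ (C.support : Set W) ⊆ Scheme.hsStratum W 3 ν ∧
          ((Scheme.hsStratum W 3 ν).Nonempty → (C.support : Set W).Nonempty))
    (hτt : ∀ (W : Scheme.{0}) (hW : IsLocallyNoetherian W) (L : Labelling W) (P : Option (Pending W)) (E : Boundary W),
      StrategyE.RunReachableState p (π.hybrid τ) 3 ν E₀ W hW L P E →
      (Scheme.hsStratum W 3 ν).Nonempty → ∃ (C : W.IdealSheafData) (P' : Option (Pending (blowup C))), τ.step W hW 3 ν L P E C P')
    {Y : Scheme.{0}} [hY : IsLocallyNoetherian Y] {y : Y} (hy : IsMaximalOrigin p 3 ν Y y) {d : ℕ}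
    (hd : topologicalKrullDim Y ≤ (d : WithBot ℕ∞))
    (hno : ∀ y' : Y, y' ∈ Scheme.hsStratum Y 3 ν → IsClosed ({y'} : Set Y) →
      ¬ ∃ c : ℕ → MarkedStageE.{0}, c 0 = MarkedStageE.init Y y' (E₀ Y y) ∧
        ∀ n, CanonicalNearStepσE (π.hybrid τ) 3 ν (c n) (c (n + 1))) :
    TameWild.NuMod Y 3 d ν :=
  nuMod_of_hybrid_noInfiniteNearChain hπd hπf hτf hτne (stateScopeGood_runReachableState_hybrid hπd hν hτa) hν hτa hτt hy hd hno

/-- **… with the fallback of record `τ := StrategyE.ofStageOracleE ω`** (`ω` functional), `StateScopeGood`-free. [cite: CossartJannsenSaito2020, Rem. 6.29 (1), Def. 6.14] -/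
theorem nuMod_of_hybrid_ofStageOracleE_noInfiniteNearChain' {ω : StageOracleE.{0}} (hπd : π.IsMenuDisciplined 3 ν)
    (hπf : π.IsFunctional 3 ν) (hω : OracleFunctionalΩE ω) (hν : ν ≠ iterPSum 3 Phi)
    (hτa : ∀ (W : Scheme.{0}) (hW : IsLocallyNoetherian W) (L : Labelling W) (P : Option (Pending W)) (E : Boundary W),
      StrategyE.RunReachableState p (π.hybrid (StrategyE.ofStageOracleE ω)) 3 ν E₀ W hW L P E →
      ∀ (C : W.IdealSheafData) (P' : Option (Pending (blowup C))), IsCanonicalStepΩE ω hW 3 ν L E P C P' →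
        IdealSheafData.IsPermissible C ∧ (C.support : Set W) ⊆ Scheme.hsStratum W 3 ν ∧
          ((Scheme.hsStratum W 3 ν).Nonempty → (C.support : Set W).Nonempty))
    (hτt : ∀ (W : Scheme.{0}) (hW : IsLocallyNoetherian W) (L : Labelling W) (P : Option (Pending W)) (E : Boundary W),
      StrategyE.RunReachableState p (π.hybrid (StrategyE.ofStageOracleE ω)) 3 ν E₀ W hW L P E →
      (Scheme.hsStratum W 3 ν).Nonempty →
        ∃ (C : W.IdealSheafData) (P' : Option (Pending (blowup C))), IsCanonicalStepΩE ω hW 3 ν L E P C P')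
    {Y : Scheme.{0}} [hY : IsLocallyNoetherian Y] {y : Y} (hy : IsMaximalOrigin p 3 ν Y y) {d : ℕ}
    (hd : topologicalKrullDim Y ≤ (d : WithBot ℕ∞))
    (hno : ∀ y' : Y, y' ∈ Scheme.hsStratum Y 3 ν → IsClosed ({y'} : Set Y) →
      ¬ ∃ c : ℕ → MarkedStageE.{0}, c 0 = MarkedStageE.init Y y' (E₀ Y y) ∧
        ∀ n, CanonicalNearStepσE (π.hybrid (StrategyE.ofStageOracleE ω)) 3 ν (c n) (c (n + 1))) :
    TameWild.NuMod Y 3 d ν :=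
  nuMod_of_hybrid_noInfiniteNearChain' hπd hπf (StrategyE.isFunctional_ofStageOracleE hω 3 ν)
    (StrategyE.stepsOnlyWhileNonempty_ofStageOracleE ω 3 ν) hν hτa hτt hy hd hno

end Packaging

end Summit.ResolutionOfSingularities.ResolutionOfSingularities.Theorems.SigmaMaxModificationsCorridor3.Sigma

end
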